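import Literature.Geometry.Lorentzian.KerrRedShiftBulk
import Literature.Geometry.Lorentzian.KerrStarChartBounds
import Literature.Geometry.Lorentzian.KerrSurfaceGravity

/-!
# Unit-temperature front face, part 1: the Kerr–Schild metric on the Kerr-star frame

Support file for the stub `stub_unitTemperatureFace` (S1) of the line `unit-temperature-front-face`
for the crux `NearExtremalKappaCapture` (route `PhaseMixingCapture`).

At the Kerr–Schild point `pt = (0, Y_a(r, θ, φ))`, `Y_a = Kerr.kerrStar` (`r > 0`), the Kerr–Schild
null covector is `ℓ = (1, n̂)` with `n̂ = sphRadial θ φ` (`Kerr.nullSpatial_kerrStar`), so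
`g_{M,a}(v, w) = η(v, w) + 2H ℓ(v) ℓ(w)` (`Kerr.bilin_apply`, `H = Kerr.scalarH M a pt`) is explicit on
the four vectors `T = ∂₀`, `E₁ = (0, n̂)`, `E₂ = (0, r θ̂ + a cos θ φ̂)`, `Φ = Kerr.axialVector pt`:
this file records the values (`g(T,T) = −1 + 2H` is `Kerr.bilin_apply` itself) `g(T,E₁) = 2H`, `g(T,E₂) = 0`,
`g(T,Φ) = −2Ha sin²θ`, `g(E₁,E₁) = 1 + 2H`, `g(E₁,E₂) = 0`, `g(E₁,Φ) = −a sin²θ(1 + 2H)`,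
`g(E₂,E₂) = r² + a² cos²θ`, `g(E₂,Φ) = 0`, `g(Φ,Φ) = sin²θ(r² + a²) + 2Ha² sin⁴θ` (with `sin²θ`
written as `1 − cos²θ`), and the elementary parameter identities of the family `a = M√(1 − σ²)`:
`r₊ = M(1+σ)`, `r₋ = M(1−σ)`, `κ = σ/(2M(1+σ))`, `ω₊ = √(1−σ²)/(2M(1+σ))`.
Pure trigonometric / square-root algebra over the tree's Kerr–Schild definitions; no named fact.
-/

noncomputable section

-- the doubled `FinalStateConjecture.FinalStateConjecture` path component trips dupNamespace
set_option linter.dupNamespace false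

namespace Summit.FinalStateConjecture.FinalStateConjecture.Theorems.NearExtremalKappaCapture.UnitTemperatureFrontFace

open Literature.Geometry.Lorentzian Real
open Set

/-! ## The null covector and the frame components at a Kerr-star point -/

/-- `ℓ(v) = v⁰ + n̂ · v⃗` at `pt = (0, Y_a(r, θ, φ))`, `r > 0` (`ℓ = (1, n̂)` there). -/
theorem nullCovector_kerrStar_apply (a : ℝ) {r : ℝ} (hr : 0 < r) (θ φ : ℝ) (v : E4) :
    Kerr.nullCovector a (E4.ofTimeSpace 0 (Kerr.kerrStar a r θ φ)) v =
      v 0 + ∑ i : Fin 3, sphRadial θ φ i * v i.succ := by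
  rw [Kerr.nullCovector, E4.covector_apply, Fin.sum_univ_succ]
  congr 1
  · simp [Kerr.nullCovectorFun]
  · refine Finset.sum_congr rfl fun i _ ↦ ?_
    rw [← Kerr.nullSpatial_apply, Kerr.nullSpatial_kerrStar a hr]

/-- Component `3` of `(t, y)` is `y 2` (companion of `Kerr.ofTimeSpace_apply_one_eq`, `_two_eq`). -/
theorem ofTimeSpace_apply_three_eq (t : ℝ) (y : E3) : E4.ofTimeSpace t y 3 = y 2 :=
  E4.ofTimeSpace_apply_succ t y 2

/-- `ℓ(0, n̂) = n̂ · n̂ = 1` at a Kerr-star point. -/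
theorem nullCovector_radial (a : ℝ) {r : ℝ} (hr : 0 < r) (θ φ : ℝ) :
    Kerr.nullCovector a (E4.ofTimeSpace 0 (Kerr.kerrStar a r θ φ))
      (E4.ofTimeSpace 0 (sphRadial θ φ)) = 1 := by
  rw [nullCovector_kerrStar_apply a hr]
  simp only [Fin.sum_univ_three, E4.ofTimeSpace_apply_zero, E4.ofTimeSpace_apply_succ,
    sphRadial_apply_zero, sphRadial_apply_one, sphRadial_apply_two]
  linear_combination sin θ ^ 2 * sin_sq_add_cos_sq φ + sin_sq_add_cos_sq θ

/-- `ℓ(0, r θ̂ + a cos θ φ̂) = 0` at a Kerr-star point (`n̂ ⊥ θ̂, φ̂`). -/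
theorem nullCovector_polar (a : ℝ) {r : ℝ} (hr : 0 < r) (θ φ : ℝ) :
    Kerr.nullCovector a (E4.ofTimeSpace 0 (Kerr.kerrStar a r θ φ))
      (E4.ofTimeSpace 0 (r • sphPolar θ φ + (a * cos θ) • sphAzimuth φ)) = 0 := by
  rw [nullCovector_kerrStar_apply a hr]
  simp only [Fin.sum_univ_three, E4.ofTimeSpace_apply_zero, E4.ofTimeSpace_apply_succ,
    sphRadial_apply_zero, sphRadial_apply_one, sphRadial_apply_two, PiLp.add_apply,
    PiLp.smul_apply, smul_eq_mul, sphPolar_apply_zero, sphPolar_apply_one, sphPolar_apply_two,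
    sphAzimuth_apply_zero, sphAzimuth_apply_one, sphAzimuth_apply_two]
  linear_combination (r * sin θ * cos θ) * sin_sq_add_cos_sq φ

/-- `ℓ(Φ) = −a sin²θ = −a(1 − cos²θ)` at a Kerr-star point. -/
theorem nullCovector_axial (a : ℝ) {r : ℝ} (hr : 0 < r) (θ φ : ℝ) :
    Kerr.nullCovector a (E4.ofTimeSpace 0 (Kerr.kerrStar a r θ φ))
      (Kerr.axialVector (E4.ofTimeSpace 0 (Kerr.kerrStar a r θ φ))) = -(a * (1 - cos θ ^ 2)) := by
  rw [nullCovector_kerrStar_apply a hr]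
  simp only [Fin.sum_univ_three, Fin.succ_zero_eq_one, Fin.succ_one_eq_two,
    show (2 : Fin 3).succ = 3 from rfl, Kerr.axialVector_apply_zero, Kerr.axialVector_apply_one,
    Kerr.axialVector_apply_two, Kerr.axialVector_apply_three, Kerr.ofTimeSpace_apply_one_eq,
    Kerr.ofTimeSpace_apply_two_eq, Kerr.kerrStar_apply_zero, Kerr.kerrStar_apply_one,
    sphRadial_apply_zero, sphRadial_apply_one, sphRadial_apply_two]
  linear_combination (-(a * sin θ ^ 2)) * sin_sq_add_cos_sq φ + (-a) * sin_sq_add_cos_sq θ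

/-- `η((0, n̂), (0, n̂)) = 1`. -/
theorem minkowski_radial_radial (θ φ : ℝ) :
    Minkowski.bilin (E4.ofTimeSpace 0 (sphRadial θ φ)) (E4.ofTimeSpace 0 (sphRadial θ φ)) = 1 := by
  simp only [Minkowski.bilin_apply, Fin.sum_univ_three, E4.ofTimeSpace_apply_zero,
    E4.ofTimeSpace_apply_succ, sphRadial_apply_zero, sphRadial_apply_one, sphRadial_apply_two]
  linear_combination sin θ ^ 2 * sin_sq_add_cos_sq φ + sin_sq_add_cos_sq θ

/-- `η((0, n̂), (0, r θ̂ + a cos θ φ̂)) = 0`. -/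
theorem minkowski_radial_polar (a r θ φ : ℝ) :
    Minkowski.bilin (E4.ofTimeSpace 0 (sphRadial θ φ))
      (E4.ofTimeSpace 0 (r • sphPolar θ φ + (a * cos θ) • sphAzimuth φ)) = 0 := by
  simp only [Minkowski.bilin_apply, Fin.sum_univ_three, E4.ofTimeSpace_apply_zero,
    E4.ofTimeSpace_apply_succ, sphRadial_apply_zero, sphRadial_apply_one, sphRadial_apply_two,
    PiLp.add_apply, PiLp.smul_apply, smul_eq_mul, sphPolar_apply_zero, sphPolar_apply_one,
    sphPolar_apply_two, sphAzimuth_apply_zero, sphAzimuth_apply_one, sphAzimuth_apply_two]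
  linear_combination (r * sin θ * cos θ) * sin_sq_add_cos_sq φ

/-- `η((0, n̂), Φ) = −a sin²θ` at a Kerr-star point. -/
theorem minkowski_radial_axial (a r θ φ : ℝ) :
    Minkowski.bilin (E4.ofTimeSpace 0 (sphRadial θ φ))
      (Kerr.axialVector (E4.ofTimeSpace 0 (Kerr.kerrStar a r θ φ))) = -(a * (1 - cos θ ^ 2)) := by
  simp only [Minkowski.bilin_apply, Fin.sum_univ_three, Fin.succ_zero_eq_one, Fin.succ_one_eq_two,
    show (2 : Fin 3).succ = 3 from rfl, Kerr.axialVector_apply_zero, Kerr.axialVector_apply_one,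
    Kerr.axialVector_apply_two, Kerr.axialVector_apply_three, Kerr.ofTimeSpace_apply_one_eq,
    Kerr.ofTimeSpace_apply_two_eq, ofTimeSpace_apply_three_eq, E4.ofTimeSpace_apply_zero,
    Kerr.kerrStar_apply_zero, Kerr.kerrStar_apply_one, sphRadial_apply_zero, sphRadial_apply_one,
    sphRadial_apply_two]
  linear_combination (-(a * sin θ ^ 2)) * sin_sq_add_cos_sq φ + (-a) * sin_sq_add_cos_sq θ

/-- `η((0, r θ̂ + a cos θ φ̂), (0, r θ̂ + a cos θ φ̂)) = r² + a² cos²θ`. -/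
theorem minkowski_polar_polar (a r θ φ : ℝ) :
    Minkowski.bilin (E4.ofTimeSpace 0 (r • sphPolar θ φ + (a * cos θ) • sphAzimuth φ))
      (E4.ofTimeSpace 0 (r • sphPolar θ φ + (a * cos θ) • sphAzimuth φ)) =
      r ^ 2 + a ^ 2 * cos θ ^ 2 := by
  simp only [Minkowski.bilin_apply, Fin.sum_univ_three, E4.ofTimeSpace_apply_zero,
    E4.ofTimeSpace_apply_succ, PiLp.add_apply, PiLp.smul_apply, smul_eq_mul, sphPolar_apply_zero,
    sphPolar_apply_one, sphPolar_apply_two, sphAzimuth_apply_zero, sphAzimuth_apply_one,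
    sphAzimuth_apply_two]
  linear_combination (cos θ ^ 2 * (r ^ 2 + a ^ 2)) * sin_sq_add_cos_sq φ + r ^ 2 * sin_sq_add_cos_sq θ

/-- `η((0, r θ̂ + a cos θ φ̂), Φ) = 0` at a Kerr-star point. -/
theorem minkowski_polar_axial (a r θ φ : ℝ) :
    Minkowski.bilin (E4.ofTimeSpace 0 (r • sphPolar θ φ + (a * cos θ) • sphAzimuth φ))
      (Kerr.axialVector (E4.ofTimeSpace 0 (Kerr.kerrStar a r θ φ))) = 0 := by
  simp only [Minkowski.bilin_apply, Fin.sum_univ_three, Fin.succ_zero_eq_one, Fin.succ_one_eq_two,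
    show (2 : Fin 3).succ = 3 from rfl, Kerr.axialVector_apply_zero, Kerr.axialVector_apply_one,
    Kerr.axialVector_apply_two, Kerr.axialVector_apply_three, Kerr.ofTimeSpace_apply_one_eq,
    Kerr.ofTimeSpace_apply_two_eq, ofTimeSpace_apply_three_eq, E4.ofTimeSpace_apply_zero,
    Kerr.kerrStar_apply_zero, Kerr.kerrStar_apply_one, PiLp.add_apply, PiLp.smul_apply, smul_eq_mul,
    sphPolar_apply_zero, sphPolar_apply_one, sphPolar_apply_two, sphAzimuth_apply_zero,
    sphAzimuth_apply_one, sphAzimuth_apply_two]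
  ring

/-- `η(Φ, Φ) = sin²θ (r² + a²)` at a Kerr-star point. -/
theorem minkowski_axial_axial (a r θ φ : ℝ) :
    Minkowski.bilin (Kerr.axialVector (E4.ofTimeSpace 0 (Kerr.kerrStar a r θ φ)))
      (Kerr.axialVector (E4.ofTimeSpace 0 (Kerr.kerrStar a r θ φ))) =
      (1 - cos θ ^ 2) * (r ^ 2 + a ^ 2) := by
  simp only [Minkowski.bilin_apply, Fin.sum_univ_three, Fin.succ_zero_eq_one, Fin.succ_one_eq_two,
    show (2 : Fin 3).succ = 3 from rfl, Kerr.axialVector_apply_zero, Kerr.axialVector_apply_one,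
    Kerr.axialVector_apply_two, Kerr.axialVector_apply_three, Kerr.ofTimeSpace_apply_one_eq,
    Kerr.ofTimeSpace_apply_two_eq, Kerr.kerrStar_apply_zero, Kerr.kerrStar_apply_one]
  linear_combination ((r ^ 2 + a ^ 2) * sin θ ^ 2) * sin_sq_add_cos_sq φ +
    (r ^ 2 + a ^ 2) * sin_sq_add_cos_sq θ

/-- `η(T, (t?, y))`: `η(∂₀, (0, y)) = 0`. -/
theorem minkowski_time_ofTimeSpace (y : E3) :
    Minkowski.bilin (E4.basisVector 0) (E4.ofTimeSpace 0 y) = 0 := by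
  rw [Minkowski.bilin_basisVector_zero_left, E4.ofTimeSpace_apply_zero, neg_zero]

/-! ## The ten metric values `g(·,·) = η(·,·) + 2H ℓ(·) ℓ(·)` on the frame -/

/-- `g(T, (0, n̂)) = 2H` at a Kerr-star point. -/
theorem bilin_time_radial (M a : ℝ) {r : ℝ} (hr : 0 < r) (θ φ : ℝ) :
    Kerr.bilin M a (E4.ofTimeSpace 0 (Kerr.kerrStar a r θ φ)) (E4.basisVector 0)
      (E4.ofTimeSpace 0 (sphRadial θ φ)) =
      2 * Kerr.scalarH M a (E4.ofTimeSpace 0 (Kerr.kerrStar a r θ φ)) := by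
  rw [Kerr.bilin_apply, minkowski_time_ofTimeSpace, Kerr.nullCovector_basisVector_zero,
    nullCovector_radial a hr]
  ring

/-- `g(T, (0, r θ̂ + a cos θ φ̂)) = 0` at a Kerr-star point. -/
theorem bilin_time_polar (M a : ℝ) {r : ℝ} (hr : 0 < r) (θ φ : ℝ) :
    Kerr.bilin M a (E4.ofTimeSpace 0 (Kerr.kerrStar a r θ φ)) (E4.basisVector 0)
      (E4.ofTimeSpace 0 (r • sphPolar θ φ + (a * cos θ) • sphAzimuth φ)) = 0 := by
  rw [Kerr.bilin_apply, minkowski_time_ofTimeSpace, Kerr.nullCovector_basisVector_zero,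
    nullCovector_polar a hr]
  ring

/-- `g(T, Φ) = −2Ha sin²θ` at a Kerr-star point. -/
theorem bilin_time_axial (M a : ℝ) {r : ℝ} (hr : 0 < r) (θ φ : ℝ) :
    Kerr.bilin M a (E4.ofTimeSpace 0 (Kerr.kerrStar a r θ φ)) (E4.basisVector 0)
      (Kerr.axialVector (E4.ofTimeSpace 0 (Kerr.kerrStar a r θ φ))) =
      -(2 * Kerr.scalarH M a (E4.ofTimeSpace 0 (Kerr.kerrStar a r θ φ)) * a * (1 - cos θ ^ 2)) := by
  rw [Kerr.bilin_apply, Kerr.minkowski_basisVector_zero_axialVector,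
    Kerr.nullCovector_basisVector_zero, nullCovector_axial a hr]
  ring

/-- `g((0, n̂), (0, n̂)) = 1 + 2H` at a Kerr-star point. -/
theorem bilin_radial_radial (M a : ℝ) {r : ℝ} (hr : 0 < r) (θ φ : ℝ) :
    Kerr.bilin M a (E4.ofTimeSpace 0 (Kerr.kerrStar a r θ φ)) (E4.ofTimeSpace 0 (sphRadial θ φ))
      (E4.ofTimeSpace 0 (sphRadial θ φ)) =
      1 + 2 * Kerr.scalarH M a (E4.ofTimeSpace 0 (Kerr.kerrStar a r θ φ)) := by
  rw [Kerr.bilin_apply, minkowski_radial_radial, nullCovector_radial a hr]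
  ring

/-- `g((0, n̂), (0, r θ̂ + a cos θ φ̂)) = 0` at a Kerr-star point. -/
theorem bilin_radial_polar (M a : ℝ) {r : ℝ} (hr : 0 < r) (θ φ : ℝ) :
    Kerr.bilin M a (E4.ofTimeSpace 0 (Kerr.kerrStar a r θ φ)) (E4.ofTimeSpace 0 (sphRadial θ φ))
      (E4.ofTimeSpace 0 (r • sphPolar θ φ + (a * cos θ) • sphAzimuth φ)) = 0 := by
  rw [Kerr.bilin_apply, minkowski_radial_polar, nullCovector_polar a hr]
  ring

/-- `g((0, n̂), Φ) = −a sin²θ (1 + 2H)` at a Kerr-star point. -/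
theorem bilin_radial_axial (M a : ℝ) {r : ℝ} (hr : 0 < r) (θ φ : ℝ) :
    Kerr.bilin M a (E4.ofTimeSpace 0 (Kerr.kerrStar a r θ φ)) (E4.ofTimeSpace 0 (sphRadial θ φ))
      (Kerr.axialVector (E4.ofTimeSpace 0 (Kerr.kerrStar a r θ φ))) =
      -(a * (1 - cos θ ^ 2) * (1 + 2 * Kerr.scalarH M a (E4.ofTimeSpace 0 (Kerr.kerrStar a r θ φ)))) := by
  rw [Kerr.bilin_apply, minkowski_radial_axial, nullCovector_radial a hr, nullCovector_axial a hr]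
  ring

/-- `g((0, r θ̂ + a cos θ φ̂), (0, r θ̂ + a cos θ φ̂)) = r² + a² cos²θ` (`= Σ`) at a Kerr-star point. -/
theorem bilin_polar_polar (M a : ℝ) {r : ℝ} (hr : 0 < r) (θ φ : ℝ) :
    Kerr.bilin M a (E4.ofTimeSpace 0 (Kerr.kerrStar a r θ φ))
      (E4.ofTimeSpace 0 (r • sphPolar θ φ + (a * cos θ) • sphAzimuth φ))
      (E4.ofTimeSpace 0 (r • sphPolar θ φ + (a * cos θ) • sphAzimuth φ)) =
      r ^ 2 + a ^ 2 * cos θ ^ 2 := by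
  rw [Kerr.bilin_apply, minkowski_polar_polar, nullCovector_polar a hr]
  ring

/-- `g((0, r θ̂ + a cos θ φ̂), Φ) = 0` at a Kerr-star point. -/
theorem bilin_polar_axial (M a : ℝ) {r : ℝ} (hr : 0 < r) (θ φ : ℝ) :
    Kerr.bilin M a (E4.ofTimeSpace 0 (Kerr.kerrStar a r θ φ))
      (E4.ofTimeSpace 0 (r • sphPolar θ φ + (a * cos θ) • sphAzimuth φ))
      (Kerr.axialVector (E4.ofTimeSpace 0 (Kerr.kerrStar a r θ φ))) = 0 := by
  rw [Kerr.bilin_apply, minkowski_polar_axial, nullCovector_polar a hr]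
  ring

/-- `g(Φ, Φ) = sin²θ (r² + a²) + 2H a² sin⁴θ` at a Kerr-star point. -/
theorem bilin_axial_axial (M a : ℝ) {r : ℝ} (hr : 0 < r) (θ φ : ℝ) :
    Kerr.bilin M a (E4.ofTimeSpace 0 (Kerr.kerrStar a r θ φ))
      (Kerr.axialVector (E4.ofTimeSpace 0 (Kerr.kerrStar a r θ φ)))
      (Kerr.axialVector (E4.ofTimeSpace 0 (Kerr.kerrStar a r θ φ))) =
      (1 - cos θ ^ 2) * (r ^ 2 + a ^ 2) +
        2 * Kerr.scalarH M a (E4.ofTimeSpace 0 (Kerr.kerrStar a r θ φ)) * a ^ 2 *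
          (1 - cos θ ^ 2) ^ 2 := by
  rw [Kerr.bilin_apply, minkowski_axial_axial, nullCovector_axial a hr]
  ring

/-! ## Parameter identities of the family `a = M √(1 − σ²)` -/

/-- `(√(1 − s²))² = 1 − s²` for `s² ≤ 1`. -/
theorem sq_sqrt_one_sub_sq {s : ℝ} (hs : s ^ 2 ≤ 1) : √(1 - s ^ 2) ^ 2 = 1 - s ^ 2 :=
  Real.sq_sqrt (sub_nonneg.2 hs)

/-- `a² = M²(1 − σ²)` for `a = M√(1 − σ²)`, `σ² ≤ 1`. -/
theorem sq_param {M s a : ℝ} (hs : s ^ 2 ≤ 1) (ha : a = M * √(1 - s ^ 2)) :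
    a ^ 2 = M ^ 2 * (1 - s ^ 2) := by
  rw [ha, mul_pow, sq_sqrt_one_sub_sq hs]

/-- `√(M² − a²) = Mσ` for `a = M√(1 − σ²)`, `M, σ ≥ 0`, `σ² ≤ 1`. -/
theorem sqrt_sq_sub_sq_param {M s a : ℝ} (hM : 0 ≤ M) (hs0 : 0 ≤ s) (hs : s ^ 2 ≤ 1)
    (ha : a = M * √(1 - s ^ 2)) : √(M ^ 2 - a ^ 2) = M * s := by
  rw [sq_param hs ha, show M ^ 2 - M ^ 2 * (1 - s ^ 2) = (M * s) ^ 2 by ring]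
  exact Real.sqrt_sq (mul_nonneg hM hs0)

/-- `r₊ = M(1 + σ)` for `a = M√(1 − σ²)`. -/
theorem rPlus_param {M s a : ℝ} (hM : 0 ≤ M) (hs0 : 0 ≤ s) (hs : s ^ 2 ≤ 1)
    (ha : a = M * √(1 - s ^ 2)) : Kerr.rPlus M a = M * (1 + s) := by
  rw [Kerr.rPlus, sqrt_sq_sub_sq_param hM hs0 hs ha]
  ring

/-- `r₋ = M(1 − σ)` for `a = M√(1 − σ²)`. -/
theorem rMinus_param {M s a : ℝ} (hM : 0 ≤ M) (hs0 : 0 ≤ s) (hs : s ^ 2 ≤ 1)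
    (ha : a = M * √(1 - s ^ 2)) : Kerr.rMinus M a = M * (1 - s) := by
  rw [Kerr.rMinus, sqrt_sq_sub_sq_param hM hs0 hs ha]
  ring

/-- `r₊ − r₋ = 2Mσ` for `a = M√(1 − σ²)`. -/
theorem rPlus_sub_rMinus_param {M s a : ℝ} (hM : 0 ≤ M) (hs0 : 0 ≤ s) (hs : s ^ 2 ≤ 1)
    (ha : a = M * √(1 - s ^ 2)) : Kerr.rPlus M a - Kerr.rMinus M a = 2 * M * s := by
  rw [rPlus_param hM hs0 hs ha, rMinus_param hM hs0 hs ha]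
  ring

/-- The blown-up radius: `r₊ + x̂ (r₊ − r₋) = M(1 + σ + 2σx̂)` for `a = M√(1 − σ²)`. -/
theorem radius_param {M s a : ℝ} (hM : 0 ≤ M) (hs0 : 0 ≤ s) (hs : s ^ 2 ≤ 1)
    (ha : a = M * √(1 - s ^ 2)) (x : ℝ) :
    Kerr.rPlus M a + x * (Kerr.rPlus M a - Kerr.rMinus M a) = M * (1 + s + 2 * s * x) := by
  rw [rPlus_sub_rMinus_param hM hs0 hs ha, rPlus_param hM hs0 hs ha]
  ring

/-- `κ = σ / (2M(1 + σ))` for `a = M√(1 − σ²)`, `M > 0`, `0 ≤ σ`, `σ² ≤ 1`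
(`κ = √(M² − a²)/(r₊² + a²)`, `r₊² + a² = 2M²(1 + σ)`). -/
theorem surfaceGravity_param {M s a : ℝ} (hM : 0 < M) (hs0 : 0 ≤ s) (hs : s ^ 2 ≤ 1)
    (ha : a = M * √(1 - s ^ 2)) : Kerr.surfaceGravity M a = s / (2 * M * (1 + s)) := by
  rw [Kerr.surfaceGravity, sqrt_sq_sub_sq_param hM.le hs0 hs ha, rPlus_param hM.le hs0 hs ha,
    sq_param hs ha, show (M * (1 + s)) ^ 2 + M ^ 2 * (1 - s ^ 2) = (2 * M * (1 + s)) * M by ring,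
    mul_comm M s, mul_div_mul_right _ _ hM.ne']

/-- `ω₊ = a / (2M²(1 + σ))` for `a = M√(1 − σ²)`, `M > 0` (`ω₊ = a/(2Mr₊)`). -/
theorem horizonAngularVelocity_param {M s a : ℝ} (hM : 0 < M) (hs0 : 0 ≤ s) (hs : s ^ 2 ≤ 1)
    (ha : a = M * √(1 - s ^ 2)) :
    Kerr.horizonAngularVelocity M a = a / (2 * M ^ 2 * (1 + s)) := by
  rw [Kerr.horizonAngularVelocity, rPlus_param hM.le hs0 hs ha]
  ring

/-- `ω₊ · a = (1 − σ)/2` for `a = M√(1 − σ²)`, `M > 0`. -/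
theorem horizonAngularVelocity_mul_param {M s a : ℝ} (hM : 0 < M) (hs0 : 0 ≤ s) (hs : s ^ 2 ≤ 1)
    (ha : a = M * √(1 - s ^ 2)) : Kerr.horizonAngularVelocity M a * a = (1 - s) / 2 := by
  rw [horizonAngularVelocity_param hM hs0 hs ha, div_mul_eq_mul_div, ← sq, sq_param hs ha]
  have h1 : (1 + s) ≠ 0 := by positivity
  have hM' : M ≠ 0 := hM.ne'
  field_simp
  ring

/-- `ω₊² = (1 − σ)/(4M²(1 + σ))` for `a = M√(1 − σ²)`, `M > 0`. -/
theorem horizonAngularVelocity_sq_param {M s a : ℝ} (hM : 0 < M) (hs0 : 0 ≤ s) (hs : s ^ 2 ≤ 1)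
    (ha : a = M * √(1 - s ^ 2)) :
    Kerr.horizonAngularVelocity M a ^ 2 = (1 - s) / (4 * M ^ 2 * (1 + s)) := by
  rw [horizonAngularVelocity_param hM hs0 hs ha, div_pow, sq_param hs ha]
  have h1 : (1 + s) ≠ 0 := by positivity
  have hM' : M ≠ 0 := hM.ne'
  field_simp
  ring

/-- On the box `σ ≥ 0`, `x̂ ≥ −1/2`: `1 + σ + 2σx̂ ≥ 1 > 0`. -/
theorem one_add_param_pos {s x : ℝ} (hs0 : 0 ≤ s) (hx : -(1 / 2) ≤ x) : 0 < 1 + s + 2 * s * x := by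
  nlinarith [mul_nonneg hs0 (show 0 ≤ x + 1 / 2 by linarith)]

/-- On the box: `D = (1 + σ + 2σx̂)² + (1 − σ²)c² > 0` for `0 ≤ σ`, `σ² ≤ 1`, `x̂ ≥ −1/2`. -/
theorem denom_param_pos {s x : ℝ} (hs0 : 0 ≤ s) (hs : s ^ 2 ≤ 1) (hx : -(1 / 2) ≤ x) (c : ℝ) :
    0 < (1 + s + 2 * s * x) ^ 2 + (1 - s ^ 2) * c ^ 2 := by
  have h1 := one_add_param_pos hs0 hx
  have h2 : 0 ≤ (1 - s ^ 2) * c ^ 2 := mul_nonneg (sub_nonneg.2 hs) (sq_nonneg c)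
  positivity

/-- `H = Mr/Σ = (1 + σ + 2σx̂)/D` at the blown-up point, `D = (1 + σ + 2σx̂)² + (1 − σ²)cos²θ = Σ/M²`,
for `a = M√(1 − σ²)`, `r = M(1 + σ + 2σx̂)`, `M > 0`, `σ ≥ 0`, `x̂ ≥ −1/2`. -/
theorem scalarH_param {M s x a r : ℝ} (hM : 0 < M) (hs0 : 0 ≤ s) (hs : s ^ 2 ≤ 1)
    (hx : -(1 / 2) ≤ x) (ha : a = M * √(1 - s ^ 2)) (hr : r = M * (1 + s + 2 * s * x)) (θ φ : ℝ) :
    Kerr.scalarH M a (E4.ofTimeSpace 0 (Kerr.kerrStar a r θ φ)) =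
      (1 + s + 2 * s * x) / ((1 + s + 2 * s * x) ^ 2 + (1 - s ^ 2) * cos θ ^ 2) := by
  have hρ := one_add_param_pos hs0 hx
  have hr0 : 0 < r := hr ▸ mul_pos hM hρ
  have hD := (denom_param_pos hs0 hs hx (cos θ)).ne'
  have hD' : r ^ 2 + a ^ 2 * cos θ ^ 2 ≠ 0 := by positivity
  rw [Kerr.scalarH_kerrStar M a hr0, div_eq_div_iff hD' hD, sq_param hs ha, hr]
  ring

end Summit.FinalStateConjecture.FinalStateConjecture.Theorems.NearExtremalKappaCapture.UnitTemperatureFrontFace
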